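import Mathlib
import Summits.ValiantsHypothesis.ValiantsHypothesis.Theorems.LacunarySymmetroidMatrixDescartesCensusRealExponentsThreeByThree
import Summits.ValiantsHypothesis.ValiantsHypothesis.Theorems.LacunarySymmetroidMatrixDescartesCensusRealExponentsTwoByTwoLocus

/-!
# `MatrixDescartes` census — `3 × 3` pencils: the residue of EVERY row is open; shells and dense sets suffice (all bounds)

HONEST FRAMING.  Object-search cell `pub-symmetroid`, item `DoorA34 = PosRootLawAt 3 4 18`
(stmt-ValiantsHypothesis-19980; OPEN, typed, never asserted) and the cell's `(3,K,B)` rows at every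
count level; structure theorems for the `m = 3` rows, deciding nothing — the `3 × 3` counterpart of
`…CensusRealExponentsTwoByTwoLocus`, built on `exists_signVar_of_zeros_three` (`…ThreeByThree`).
Nothing here bears on `MatrixDescartes` (stmt-ValiantsHypothesis-18050) or `VP ≠ VNP`.

* `exists_persistent_brackets_three`, `isOpen_realRow_three` — **for every `k`, `B`, the set of real
  exponent vectors `δ ∈ ℝ^{k+1}` carrying SOME real symmetric `3 × 3` pencil with `≥ B + 1` zeros on
  `(0,∞)` is OPEN** (zeros ⇒ sign variations after a one-letter perturbation; sign variations at
  finitely many points persist under perturbation of `δ`; variations ⇒ zeros);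
* `posRootLawAt_three_of_frequently_shell` — infinitely many SHELLS suffice, every `B` (`3 × 3`);
* `posRootLawAt_three_of_dense` — for every `K`, `B`: the real row on a DENSE set of exponent
  vectors implies `PosRootLawAt 3 K B`;
* `posRootLawAt_three_iff_simplex` — the row over all real exponent vectors iff over the compact
  simplex `0 = δ₀ ≤ ⋯ ≤ δ_k = 1`;
* `not_posRootLawAt_three_iff_eventually_shell` — a failing `(3,k+1,B)` row fails on EVERY
  sufficiently large shell;
* `exists_brackets_of_le_card_posRoots_three` — **bracket certificates are COMPLETE for the `3 × 3`
  registers on a fixed integer support**: `≥ N` distinct positive det-roots for some symmetric pencil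
  on `d` ⇒ some symmetric pencil on `d` changes sign across `≥ N` disjoint positive brackets (touching
  roots are never needed to witness a register).

[folklore] IVT, Laguerre via the kit, continuity.
-/

-- `Summit.ValiantsHypothesis.ValiantsHypothesis.…` repeats a component by the D-0017 layout
-- (single-conjunct summit), which the `dupNamespace` linter flags; the name is mandated.
set_option linter.dupNamespace false

namespace Summit.ValiantsHypothesis.ValiantsHypothesis.Theorems.LacunarySymmetroidMatrixDescartes.Census.RealExp

open Finset
open scoped BigOperators Matrix
open Summit.ValiantsHypothesis.ValiantsHypothesis.Theorems.MatrixDescartes.Negative (PosRootLawAt)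

section ThreeByThreeLocus

/-- **Persistent brackets for every bound (`3 × 3`).**  If the real-exponent symmetric `3 × 3` pencil
`∑_l e^{δ_l t} S_l` has at least `N ≥ 1` zeros, then some symmetric one-letter perturbation `S'` of `S` has
`n ≥ N` increasing (possibly touching) sign-change brackets which persist for every exponent vector in a
ball around `δ`. [folklore] -/
theorem exists_persistent_brackets_three {k N : ℕ} (δ : Fin (k + 1) → ℝ)
    (S : Fin (k + 1) → Matrix (Fin 3) (Fin 3) ℝ) (hS : ∀ l, (S l).IsSymm) (hN0 : 0 < N)
    (hN : N ≤ {t : ℝ | (∑ l, Real.exp (δ l * t) • S l).det = 0}.ncard) :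
    ∃ S' : Fin (k + 1) → Matrix (Fin 3) (Fin 3) ℝ, (∀ l, (S' l).IsSymm) ∧
      ∃ n : ℕ, N ≤ n ∧ ∃ a b : Fin n → ℝ, (∀ i, a i < b i) ∧ (∀ i j, i < j → b i ≤ a j) ∧
        ∃ r : ℝ, 0 < r ∧ ∀ δ' : Fin (k + 1) → ℝ, dist δ' δ < r → ∀ i,
          (∑ l, Real.exp (δ' l * a i) • S' l).det * (∑ l, Real.exp (δ' l * b i) • S' l).det < 0 := by
  classical
  obtain ⟨W, ε, hW, M, p, hp, hvar⟩ := exists_signVar_of_zeros_three δ S hS hN0 hN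
  set S' : Fin (k + 1) → Matrix (Fin 3) (Fin 3) ℝ := Function.update S 0 (S 0 + ε • W) with hS'
  have hS'symm : ∀ l, (S' l).IsSymm := isSymm_update_zero S hS W hW ε
  obtain ⟨I, hImem⟩ : ∃ I : Finset (Fin M), ∀ i, i ∈ I ↔
      (∑ l, Real.exp (δ l * p i.castSucc) • S' l).det * (∑ l, Real.exp (δ l * p i.succ) • S' l).det < 0 :=
    ⟨univ.filter (fun i : Fin M => (∑ l, Real.exp (δ l * p i.castSucc) • S' l).det *
      (∑ l, Real.exp (δ l * p i.succ) • S' l).det < 0), fun i => by simp⟩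
  have hIcard : N ≤ I.card := by
    have hIeq : univ.filter (fun i : Fin M => (∑ l, Real.exp (δ l * p i.castSucc) • S' l).det *
        (∑ l, Real.exp (δ l * p i.succ) • S' l).det < 0) = I := by
      ext i; simp [hImem]
    rw [← hIeq]; exact hvar
  set n := I.card with hn
  set e := I.orderEmbOfFin rfl with he
  have hemem : ∀ j, e j ∈ I := fun j => Finset.orderEmbOfFin_mem I rfl j
  have hemono : StrictMono e := (I.orderEmbOfFin rfl).strictMono
  obtain ⟨r, hr, hball⟩ := brackets_persist δ S' (fun j => p (e j).castSucc) (fun j => p (e j).succ)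
    (fun j => (hImem _).mp (hemem j))
  refine ⟨S', hS'symm, n, hIcard, fun j => p (e j).castSucc, fun j => p (e j).succ,
    fun j => hp (Fin.castSucc_lt_succ), fun j j' hjj' => ?_, r, hr, hball⟩
  apply hp.monotone
  have h1 : e j < e j' := hemono hjj'
  rw [Fin.le_def, Fin.val_succ, Fin.val_castSucc]
  rw [Fin.lt_def] at h1
  omega

/-- **Every `3 × 3` residue is open.**  For all `k`, `B`: the set of real exponent vectors
`δ : Fin (k+1) → ℝ` for which SOME real symmetric `3 × 3` pencil `∑_l x^{δ_l} S_l` has at least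
`B + 1` zeros on `(0,∞)` is open in `ℝ^{k+1}` — also for NON-sharp `B`. [folklore] -/
theorem isOpen_realRow_three {k B : ℕ} :
    IsOpen {δ : Fin (k + 1) → ℝ | ∃ S : Fin (k + 1) → Matrix (Fin 3) (Fin 3) ℝ, (∀ l, (S l).IsSymm) ∧
      B + 1 ≤ {x : ℝ | 0 < x ∧ (∑ l, (x ^ (δ l)) • S l).det = 0}.ncard} := by
  classical
  rw [Metric.isOpen_iff]
  rintro δ ⟨S, hS, hcount⟩
  rw [ncard_rpow_eq_ncard_exp δ S] at hcount
  obtain ⟨S', hS', n, hnB, a, b, hab, hdisj, r, hr, hball⟩ :=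
    exists_persistent_brackets_three δ S hS (Nat.succ_pos B) hcount
  refine ⟨r, hr, fun δ' hδ' => ⟨S', hS', ?_⟩⟩
  rw [ncard_rpow_eq_ncard_exp δ' S']
  have hres := le_ncard_of_brackets_le δ' S' (by omega) hab hdisj (hball δ' (Metric.mem_ball.mp hδ'))
  exact hnB.trans hres.2

open Summit.ValiantsHypothesis.ValiantsHypothesis.Theorems.SymmetroidDescartes (eval_det_pencil) in
open Polynomial in
/-- **Infinitely many shells suffice (`3 × 3`, every bound).**  If for infinitely many spreads `N`
the row `PosRootLawOn 3 (k+1) B d` holds on every sorted integer support with `d₀ = 0`, `d_last = N`,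
then `PosRootLawAt 3 (k+1) B` — with no sharpness hypothesis. [folklore] -/
theorem posRootLawAt_three_of_frequently_shell {k B : ℕ}
    (h : ∀ N₀ : ℕ, ∃ N : ℕ, N₀ ≤ N ∧ ∀ d : Fin (k + 1) → ℕ, Monotone d → d 0 = 0 →
      d (Fin.last k) = N → PosRootLawOn 3 (k + 1) B d) :
    PosRootLawAt 3 (k + 1) B := by
  classical
  rw [posRootLawAt_three_iff_rpow, realRow_iff_simplex]
  intro δ hmono h0 h1 S hS
  by_contra hcon
  push Not at hcon
  rw [ncard_rpow_eq_ncard_exp δ S] at hcon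
  obtain ⟨S', hS', n, hnB, a, b, hab, hdisj, r, hr, hball⟩ :=
    exists_persistent_brackets_three δ S hS (Nat.succ_pos B) (by omega)
  obtain ⟨N, hN0, hN⟩ := h (⌈1 / r⌉₊ + 1)
  have hNpos : 0 < N := lt_of_lt_of_le (Nat.succ_pos _) hN0
  have hNpos' : (0 : ℝ) < N := by exact_mod_cast hNpos
  have hNr : 1 / (N : ℝ) < r := by
    have h2 : 1 / r < (N : ℝ) := by
      have h3 : (⌈1 / r⌉₊ : ℝ) + 1 ≤ N := by exact_mod_cast hN0
      exact ((Nat.le_ceil (1 / r)).trans_lt (lt_add_one _)).trans_le h3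
    exact (one_div_lt hNpos' hr).mpr h2
  have hδnonneg : ∀ l, 0 ≤ δ l := fun l => by rw [← h0]; exact hmono (Fin.zero_le l)
  set z : Fin (k + 1) → ℕ := fun l => ⌊δ l * N⌋₊ with hz
  have hzmono : Monotone z := fun i j hij =>
    Nat.floor_le_floor (mul_le_mul_of_nonneg_right (hmono hij) hNpos'.le)
  have hz0 : z 0 = 0 := by simp [hz, h0]
  have hzN : z (Fin.last k) = N := by simp [hz, h1]
  have hdist : dist (fun l => ((z l : ℕ) : ℝ) / N) δ < r := by
    rw [dist_pi_lt_iff hr]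
    intro l
    rw [Real.dist_eq]
    have h4 : ((z l : ℕ) : ℝ) ≤ δ l * N := Nat.floor_le (mul_nonneg (hδnonneg l) hNpos'.le)
    have h5 : δ l * N < ((z l : ℕ) : ℝ) + 1 := Nat.lt_floor_add_one _
    have heq : ((z l : ℕ) : ℝ) / N - δ l = (((z l : ℕ) : ℝ) - δ l * N) / N := by field_simp
    have h6 : |((z l : ℕ) : ℝ) / N - δ l| ≤ 1 / N := by
      rw [heq, abs_le]
      constructor
      · rw [le_div_iff₀ hNpos']
        have : -(1 / (N : ℝ)) * N = -1 := by field_simp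
        rw [this]; linarith
      · exact div_le_div_of_nonneg_right (by linarith) hNpos'.le
    exact h6.trans_lt hNr
  have hsign := hball (fun l => ((z l : ℕ) : ℝ) / N) hdist
  have hzeros : ∀ i, ∃ w ∈ Set.Ioo (a i) (b i),
      (∑ l, Real.exp ((((z l : ℕ) : ℝ) / N) * w) • S' l).det = 0 :=
    fun i => exists_zero_of_mul_neg (hab i)
      (continuous_det_expPencil (fun l => ((z l : ℕ) : ℝ) / N) S').continuousOn (hsign i)
  choose w hwmem hw0 using hzeros
  have hwmono : StrictMono w := by
    intro i j hij
    have h7 := (hwmem i).2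
    have h8 := (hwmem j).1
    have h9 := hdisj i j hij
    linarith
  have hpow : ∀ (l : Fin (k + 1)) (t : ℝ),
      Real.exp (t / N) ^ (z l) = Real.exp ((((z l : ℕ) : ℝ) / N) * t) := by
    intro l t
    rw [← Real.exp_nat_mul]
    congr 1
    field_simp
  set P : ℝ[X] := (∑ l, (X : ℝ[X]) ^ z l • (S' l).map C).det with hP
  have hPeval : ∀ t, P.eval (Real.exp (t / N)) =
      (∑ l, Real.exp ((((z l : ℕ) : ℝ) / N) * t) • S' l).det := by
    intro t
    rw [hP, eval_det_pencil]
    refine congrArg Matrix.det (Finset.sum_congr rfl fun l _ => ?_)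
    rw [hpow]
  have hn0 : 0 < n := by omega
  have hPne : P ≠ 0 := by
    intro hP0
    have h10 : P.eval (Real.exp (a ⟨0, hn0⟩ / N)) = 0 := by rw [hP0, eval_zero]
    rw [hPeval] at h10
    have h11 := hsign ⟨0, hn0⟩
    rw [h10, zero_mul] at h11
    exact lt_irrefl 0 h11
  set xs : Fin n → ℝ := fun i => Real.exp (w i / N) with hxs
  have hxsinj : Function.Injective xs := by
    intro i j hij
    have h12 := Real.exp_injective hij
    have h13 : w i = w j := by
      have h14 : w i / N * N = w j / N * N := by rw [h12]
      rwa [div_mul_cancel₀ _ hNpos'.ne', div_mul_cancel₀ _ hNpos'.ne'] at h14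
    exact hwmono.injective h13
  have hsub : univ.image xs ⊆ P.roots.toFinset.filter (fun x => 0 < x) := by
    intro x hx
    rw [Finset.mem_image] at hx
    obtain ⟨i, -, rfl⟩ := hx
    rw [Finset.mem_filter, Multiset.mem_toFinset, mem_roots hPne, IsRoot.def]
    refine ⟨?_, Real.exp_pos _⟩
    show P.eval (Real.exp (w i / N)) = 0
    rw [hPeval]; exact hw0 i
  have hcard := Finset.card_le_card hsub
  rw [Finset.card_image_of_injective _ hxsinj, Finset.card_univ, Fintype.card_fin] at hcard
  have hle := hN z hzmono hz0 hzN S' hS'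
  rw [← hP] at hle
  omega

/-- **`3 × 3`: a dense set of exponent vectors suffices, for every bound.** [folklore] -/
theorem posRootLawAt_three_of_dense {K B : ℕ} {D : Set (Fin K → ℝ)} (hD : Dense D)
    (h : ∀ δ ∈ D, ∀ (S : Fin K → Matrix (Fin 3) (Fin 3) ℝ), (∀ l, (S l).IsSymm) →
      {x : ℝ | 0 < x ∧ (∑ l, (x ^ (δ l)) • S l).det = 0}.ncard ≤ B) :
    PosRootLawAt 3 K B := by
  classical
  rw [posRootLawAt_three_iff_rpow]
  intro δ S hS
  rcases K.eq_zero_or_pos with hK | hK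
  · subst hK
    have : {x : ℝ | 0 < x ∧ (∑ l : Fin 0, (x ^ (δ l)) • S l).det = 0} = Set.Ioi 0 := by
      ext x; simp
    have hinf : (Set.Ioi (0 : ℝ)).Infinite := Set.Ioi_infinite 0
    rw [this, hinf.ncard]
    exact Nat.zero_le B
  obtain ⟨k, rfl⟩ : ∃ k, K = k + 1 := ⟨K - 1, by omega⟩
  by_contra hcon
  push Not at hcon
  set L : Set (Fin (k + 1) → ℝ) := {δ' : Fin (k + 1) → ℝ | ∃ S' : Fin (k + 1) → Matrix (Fin 3) (Fin 3) ℝ,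
    (∀ l, (S' l).IsSymm) ∧ B + 1 ≤ {x : ℝ | 0 < x ∧ (∑ l, (x ^ (δ' l)) • S' l).det = 0}.ncard} with hL
  have hopen : IsOpen L := isOpen_realRow_three
  have hmem : δ ∈ L := ⟨S, hS, by omega⟩
  obtain ⟨δ', hδ'L, hδ'D⟩ := hD.inter_open_nonempty L hopen ⟨δ, hmem⟩
  obtain ⟨S', hS', hcount⟩ := hδ'L
  have := h δ' hδ'D S' hS'
  omega

/-- **`3 × 3`: every row over real exponents iff over the compact simplex** `0 = δ₀ ≤ ⋯ ≤ δ_k = 1`,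
for every `B` (affine invariance, `realRow_iff_simplex`, behind the non-sharp transfer). [folklore] -/
theorem posRootLawAt_three_iff_simplex (k B : ℕ) :
    PosRootLawAt 3 (k + 1) B ↔
      ∀ (δ : Fin (k + 1) → ℝ), Monotone δ → δ 0 = 0 → δ (Fin.last k) = 1 →
        ∀ (S : Fin (k + 1) → Matrix (Fin 3) (Fin 3) ℝ), (∀ l, (S l).IsSymm) →
          {x : ℝ | 0 < x ∧ (∑ l, (x ^ (δ l)) • S l).det = 0}.ncard ≤ B := by
  rw [posRootLawAt_three_iff_rpow, realRow_iff_simplex]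

/-- **A failing `3 × 3` row fails on every large shell.**  `¬ PosRootLawAt 3 (k+1) B` iff for all
sufficiently large `N` some sorted integer support with `d₀ = 0`, `d_last = N` carries a real symmetric
`3 × 3` pencil with `≥ B + 1` distinct positive det-roots. [folklore] -/
theorem not_posRootLawAt_three_iff_eventually_shell (k B : ℕ) :
    ¬ PosRootLawAt 3 (k + 1) B ↔
      ∃ N₀ : ℕ, ∀ N : ℕ, N₀ ≤ N → ∃ d : Fin (k + 1) → ℕ, Monotone d ∧ d 0 = 0 ∧
        d (Fin.last k) = N ∧ ¬ PosRootLawOn 3 (k + 1) B d := by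
  constructor
  · intro hnot
    by_contra hall
    push Not at hall
    exact hnot (posRootLawAt_three_of_frequently_shell fun N₀ => by
      obtain ⟨N, hN0, hN⟩ := hall N₀
      exact ⟨N, hN0, fun d hd h0 h1 => hN d hd h0 h1⟩)
  · rintro ⟨N₀, hN₀⟩ hlaw
    obtain ⟨d, -, -, -, hd⟩ := hN₀ N₀ le_rfl
    exact hd (fun S hS => hlaw d S hS)

open Summit.ValiantsHypothesis.ValiantsHypothesis.Theorems.SymmetroidDescartes (eval_det_pencil) in
open Polynomial in
/-- **Bracket certificates are complete for the `3 × 3` registers (fixed support).**  If some real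
symmetric `3 × 3` pencil on the INTEGER support `d` has at least `N ≥ 1` distinct positive det-roots,
then some real symmetric pencil on the SAME support (a one-letter perturbation) has `n ≥ N` increasing,
pairwise disjoint positive brackets `0 < a_i < b_i ≤ a_{i+1}` across each of which its determinant
changes sign — so (with `le_card_posRoots_of_alternating`-type IVT rows) every census register
`ζ_sym(3,K;d) ≥ N` is certifiable by finitely many sign evaluations; touching (even-multiplicity)
roots are never needed. [folklore] -/
theorem exists_brackets_of_le_card_posRoots_three {k N : ℕ} (d : Fin (k + 1) → ℕ)
    (S : Fin (k + 1) → Matrix (Fin 3) (Fin 3) ℝ) (hS : ∀ l, (S l).IsSymm) (hN0 : 0 < N)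
    (hN : N ≤ ((∑ l, (X : ℝ[X]) ^ d l • (S l).map C).det.roots.toFinset.filter (fun x => 0 < x)).card) :
    ∃ S' : Fin (k + 1) → Matrix (Fin 3) (Fin 3) ℝ, (∀ l, (S' l).IsSymm) ∧
      ∃ n : ℕ, N ≤ n ∧ ∃ a b : Fin n → ℝ, (∀ i, 0 < a i) ∧ (∀ i, a i < b i) ∧
        (∀ i j, i < j → b i ≤ a j) ∧ ∀ i,
          ((∑ l, (X : ℝ[X]) ^ d l • (S' l).map C).det.eval (a i)) *
            ((∑ l, (X : ℝ[X]) ^ d l • (S' l).map C).det.eval (b i)) < 0 := by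
  classical
  set P : ℝ[X] := (∑ l, (X : ℝ[X]) ^ d l • (S l).map C).det with hP
  have hP0 : P ≠ 0 := by
    intro h0
    rw [h0, roots_zero, Multiset.toFinset_zero, Finset.filter_empty, Finset.card_empty] at hN
    omega
  set δ : Fin (k + 1) → ℝ := fun l => ((d l : ℕ) : ℝ) with hδ
  have hset : (↑(P.roots.toFinset.filter (fun x => 0 < x)) : Set ℝ) =
      {x : ℝ | 0 < x ∧ (∑ l, (x ^ (δ l)) • S l).det = 0} := by
    ext x
    rw [Finset.coe_filter, Set.mem_setOf_eq, Set.mem_setOf_eq, Multiset.mem_toFinset, mem_roots hP0,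
      IsRoot.def, hP, eval_det_pencil]
    simp only [hδ, Real.rpow_natCast]
    exact and_comm
  have hcount : N ≤ {t : ℝ | (∑ l, Real.exp (δ l * t) • S l).det = 0}.ncard := by
    rw [← ncard_rpow_eq_ncard_exp δ S, ← hset, Set.ncard_coe_finset]; exact hN
  obtain ⟨S', hS', n, hnN, a, b, hab, hdisj, r, hr, hball⟩ :=
    exists_persistent_brackets_three δ S hS hN0 hcount
  have hsign := hball δ (by rw [dist_self]; exact hr)
  have heval : ∀ t, ((∑ l, (X : ℝ[X]) ^ d l • (S' l).map C).det.eval (Real.exp t)) =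
      (∑ l, Real.exp (δ l * t) • S' l).det := by
    intro t
    rw [eval_det_pencil]
    refine congrArg Matrix.det (Finset.sum_congr rfl fun l _ => ?_)
    rw [hδ, ← Real.exp_nat_mul]
  refine ⟨S', hS', n, hnN, fun i => Real.exp (a i), fun i => Real.exp (b i), fun i => Real.exp_pos _,
    fun i => Real.exp_lt_exp.mpr (hab i), fun i j hij => Real.exp_le_exp.mpr (hdisj i j hij), fun i => ?_⟩
  rw [heval, heval]
  exact hsign i

end ThreeByThreeLocus

end Summit.ValiantsHypothesis.ValiantsHypothesis.Theorems.LacunarySymmetroidMatrixDescartes.Census.RealExp
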